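import Literature.NumberTheory.Transcendental.NesterenkoEliminationChowForm
import Literature.NumberTheory.Transcendental.NesterenkoEliminationNorms
import Literature.NumberTheory.Transcendental.NesterenkoEliminationFactsProofs
import HarnessLib

/-!
# Nesterenko's Corollary 4.10 (LNM 1752 Ch. 3 §4 (21), `K = ℚ`, archimedean case) — proofs only

`Literature/NumberTheory/Transcendental/NesterenkoEliminationCor410Proofs.lean` — proofs-only
sibling of `NesterenkoEliminationFacts.lean`. No new definitions, no new named facts. Main result:

* `NesterenkoPhilippon2001_ch3_cor_4_10_holds : NesterenkoPhilippon2001_ch3_cor_4_10` — the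
  discharge of the named fact vendoring LNM 1752 Ch. 3 Corollary 4.10, (21) (p. 40): for a
  homogeneous prime `𝔭 ⊂ ℚ[x₀, …, x_m]` with `dim 𝔭 = r − 1 ≥ 0` and `ω̄ ∈ ℂ^{m+1} ∖ 0`,
  `|𝔭(ω̄)| ≤ ρ(ω̄) · e^{5 m² deg 𝔭}`, `ρ(ω̄) = inf_{β̄ ∈ V(𝔭)} ‖ω̄ − β̄‖`.

## The proof

The book: "The next two Corollaries easily follow from definitions … PROOF. See [Nes10,
Corollary 2]." We give the standard argument in full, for an ARBITRARY ideal `I` in place of `𝔭`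
(`iabs_le_projDist_mul_exp`): let `F = chowForm I r` (`|I(ω̄)| = |ϰ_ω̄(F)| · |F|⁻¹ · |ω̄|^{−r deg I}`,
Definition 4.6) and `β̄ ∈ V(I)`.

1. `F` is homogeneous of degree `deg I` in each group `uᵢ`, so every monomial of `F` has total
   degree `N = r deg I` and every exponent `≤ deg I`; hence `#supp F ≤ (deg I + 1)^{r(m+1)}`
   (`bdeg_eq_ideg_of_mem_support_chowForm`, `degree_eq_of_mem_support_chowForm` of
   `NesterenkoEliminationChowForm.lean`).
2. `ϰ_{β̄'}(F) = 0` for every multiple `β̄' = c β̄` of `β̄` (the associated form vanishes at the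
   zeros of `I`: `kappa_smul_chowForm_eq_zero`, `NesterenkoEliminationChowForm.lean`); choose `β̄'`
   with `|β̄'| ≤ |ω̄|` and `max_k |ω_k − β'_k| ≤ ‖ω̄ − β̄‖ |ω̄|` (`exists_rep_near`,
   `NesterenkoEliminationFactsProofs.lean`).
3. `ϰ_ω̄(F) − ϰ_{β̄'}(F) = ∑_e a_e (ℓ(ω̄)^e − ℓ(β̄')^e)` where `ℓ(ω̄)_{ij} = (S⁽ⁱ⁾ω̄)_j` is a linear
   form in the `s⁽ⁱ⁾_{jk}` with `≤ m + 1` monomials and coefficients of modulus `≤ |ω̄|`. For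
   polynomials `|PQ| ≤ #supp(P) |P| |Q|` (`maxNorm_mul_le`, `|·|` the maximum modulus of the
   coefficients, Definition 4.1; we work with `|·|` directly rather than through the `ℓ¹`-norm of
   `NesterenkoEliminationNorms.lean`), whence by telescoping (`maxNorm_prod_sub_prod_le`)
   `|ℓ(ω̄)^e − ℓ(β̄')^e| ≤ N (m+1)^N ((m+1)|ω̄|)^{N−1} (m+1) ‖ω̄ − β̄‖ |ω̄|`, and
   `|ϰ_ω̄(F)| ≤ #supp(F) · |F| · N (m+1)^{2N} |ω̄|^N ‖ω̄ − β̄‖`.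
4. Dividing, `|I(ω̄)| ≤ #supp(F) · N · (m+1)^{2N} · ‖ω̄ − β̄‖ ≤ e^{(3m²+2m) deg I} ‖ω̄ − β̄‖
   ≤ e^{5m² deg I} ‖ω̄ − β̄‖` (`r ≤ m`, `1 + x ≤ eˣ`), and the infimum over `β̄ ∈ V(𝔭) ≠ ∅`
   (`projZeros_nonempty`) gives (21).

## References

* [NesterenkoPhilippon2001] Yu. V. Nesterenko, P. Philippon (eds.), *Introduction to Algebraic
  Independence Theory*, LNM 1752, Springer 2001, Ch. 3 (Yu. V. Nesterenko) §4, Definition 4.6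
  (p. 39) and Corollary 4.10, (21) (p. 40; PDF p. 52).
* [Nes10] Yu. V. Nesterenko, *On the measure of algebraic independence of the values of Ramanujan
  functions*, Proc. Steklov Inst. Math. 218 (1997) 294–331, §1 Corollary 2 (the proof referred to).
-/

noncomputable section

open MvPolynomial
open scoped NNReal

namespace Literature.NumberTheory.Transcendental

namespace Nesterenko

variable {m : ℕ}

/-! ### The maximum-of-coefficients norm: calculus -/

section MaxNorm

variable {σ K : Type*} [NormedField K]

/-- `|P| ≤ B` as soon as every coefficient has modulus `≤ B` (`B ≥ 0`). [folklore] -/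
theorem maxNorm_le_of_forall_le {P : MvPolynomial σ K} {B : ℝ} (hB : 0 ≤ B)
    (h : ∀ γ ∈ P.support, ‖P.coeff γ‖ ≤ B) : maxNorm P ≤ B := by
  have h1 : (P.support.sup fun γ => ‖P.coeff γ‖₊) ≤ ⟨B, hB⟩ :=
    Finset.sup_le fun γ hγ => by
      rw [← NNReal.coe_le_coe, coe_nnnorm]
      exact h γ hγ
  exact NNReal.coe_le_coe.mpr h1

/-- `|P + Q| ≤ |P| + |Q|`. [folklore] -/
theorem maxNorm_add_le (P Q : MvPolynomial σ K) : maxNorm (P + Q) ≤ maxNorm P + maxNorm Q :=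
  maxNorm_le_of_forall_le (add_nonneg (maxNorm_nonneg P) (maxNorm_nonneg Q)) fun γ _ => by
    rw [coeff_add]
    exact (norm_add_le _ _).trans (add_le_add (norm_coeff_le_maxNorm P γ) (norm_coeff_le_maxNorm Q γ))

/-- `|−P| = |P|`. [folklore] -/
theorem maxNorm_neg (P : MvPolynomial σ K) : maxNorm (-P) = maxNorm P := by
  have h : ∀ Q : MvPolynomial σ K, maxNorm (-Q) ≤ maxNorm Q := fun Q =>
    maxNorm_le_of_forall_le (maxNorm_nonneg Q) fun γ _ => by
      rw [coeff_neg, norm_neg]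
      exact norm_coeff_le_maxNorm Q γ
  refine le_antisymm (h P) ?_
  simpa using h (-P)

/-- `|P − Q| ≤ |P| + |Q|`. [folklore] -/
theorem maxNorm_sub_le (P Q : MvPolynomial σ K) : maxNorm (P - Q) ≤ maxNorm P + maxNorm Q := by
  rw [sub_eq_add_neg]
  exact (maxNorm_add_le P (-Q)).trans (by rw [maxNorm_neg])

/-- `|∑ Pᵢ| ≤ ∑ |Pᵢ|`. [folklore] -/
theorem maxNorm_sum_le {ι : Type*} (s : Finset ι) (P : ι → MvPolynomial σ K) :
    maxNorm (∑ i ∈ s, P i) ≤ ∑ i ∈ s, maxNorm (P i) :=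
  Finset.le_sum_of_subadditive (maxNorm (σ := σ) (K := K)) maxNorm_zero.le maxNorm_add_le s P

/-- `|cP| ≤ |c| |P|`. [folklore] -/
theorem maxNorm_C_mul_le (c : K) (P : MvPolynomial σ K) : maxNorm (C c * P) ≤ ‖c‖ * maxNorm P :=
  maxNorm_le_of_forall_le (mul_nonneg (norm_nonneg c) (maxNorm_nonneg P)) fun γ _ => by
    rw [coeff_C_mul, norm_mul]
    exact mul_le_mul_of_nonneg_left (norm_coeff_le_maxNorm P γ) (norm_nonneg c)

/-- `|1| ≤ 1`. [folklore] -/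
theorem maxNorm_one_le : maxNorm (1 : MvPolynomial σ K) ≤ 1 :=
  maxNorm_le_of_forall_le zero_le_one fun γ _ => by
    classical
    rw [coeff_one]
    split_ifs <;> simp

/-- `|monomial s c| ≤ |c|`. [folklore] -/
theorem maxNorm_monomial_le (s : σ →₀ ℕ) (c : K) : maxNorm (monomial s c) ≤ ‖c‖ :=
  maxNorm_le_of_forall_le (norm_nonneg c) fun γ _ => by
    classical
    rw [coeff_monomial]
    split_ifs <;> simp

/-- **`|PQ| ≤ #supp(P) · |P| · |Q|`**: a coefficient of `PQ` is a sum of at most `#supp(P)` products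
of a coefficient of `P` and a coefficient of `Q`. [folklore] -/
theorem maxNorm_mul_le (P Q : MvPolynomial σ K) :
    maxNorm (P * Q) ≤ P.support.card * maxNorm P * maxNorm Q := by
  classical
  refine maxNorm_le_of_forall_le (mul_nonneg (mul_nonneg (Nat.cast_nonneg _) (maxNorm_nonneg P))
    (maxNorm_nonneg Q)) fun γ _ => ?_
  rw [coeff_mul, ← Finset.sum_filter_of_ne (p := fun x => x.1 ∈ P.support) (fun x _ hx => by
    by_contra hxs
    rw [notMem_support_iff.mp hxs, zero_mul] at hx
    exact hx rfl)]
  set t := (Finset.HasAntidiagonal.antidiagonal γ).filter fun x => x.1 ∈ P.support with ht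
  have hcard : t.card ≤ P.support.card := by
    refine Finset.card_le_card_of_injOn (fun x => x.1) (fun x hx => ?_) ?_
    · exact (Finset.mem_filter.mp hx).2
    · intro x hx y hy hxy
      have hx' := Finset.HasAntidiagonal.mem_antidiagonal.mp (Finset.mem_filter.mp hx).1
      have hy' := Finset.HasAntidiagonal.mem_antidiagonal.mp (Finset.mem_filter.mp hy).1
      simp only at hxy
      refine Prod.ext hxy ?_
      rw [hxy] at hx'
      exact add_left_cancel (hx'.trans hy'.symm)
  calc ‖∑ x ∈ t, coeff x.1 P * coeff x.2 Q‖ ≤ ∑ x ∈ t, ‖coeff x.1 P * coeff x.2 Q‖ :=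
        norm_sum_le _ _
    _ ≤ ∑ _x ∈ t, maxNorm P * maxNorm Q := by
        refine Finset.sum_le_sum fun x _ => ?_
        rw [norm_mul]
        exact mul_le_mul (norm_coeff_le_maxNorm P _) (norm_coeff_le_maxNorm Q _) (norm_nonneg _)
          (maxNorm_nonneg P)
    _ = t.card * (maxNorm P * maxNorm Q) := by rw [Finset.sum_const, nsmul_eq_mul]
    _ ≤ P.support.card * (maxNorm P * maxNorm Q) := by
        gcongr
        · exact mul_nonneg (maxNorm_nonneg P) (maxNorm_nonneg Q)
    _ = P.support.card * maxNorm P * maxNorm Q := by ring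

/-- `|∏ᵢ fᵢ| ≤ Sⁿ Aⁿ` for `n` factors with `≤ S` monomials and `|fᵢ| ≤ A` each. [folklore] -/
theorem maxNorm_prod_le {ι : Type*} (t : Finset ι) (f : ι → MvPolynomial σ K) {S : ℕ} {A : ℝ}
    (hA : 0 ≤ A) (hs : ∀ i ∈ t, (f i).support.card ≤ S) (ha : ∀ i ∈ t, maxNorm (f i) ≤ A) :
    maxNorm (∏ i ∈ t, f i) ≤ (S : ℝ) ^ t.card * A ^ t.card := by
  classical
  induction t using Finset.induction_on with
  | empty => simpa using (maxNorm_one_le (σ := σ) (K := K))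
  | insert a t hat ih =>
    have ih' := ih (fun i hi => hs i (Finset.mem_insert_of_mem hi))
      fun i hi => ha i (Finset.mem_insert_of_mem hi)
    rw [Finset.prod_insert hat, Finset.card_insert_of_notMem hat, pow_succ, pow_succ]
    calc maxNorm (f a * ∏ i ∈ t, f i)
        ≤ (f a).support.card * maxNorm (f a) * maxNorm (∏ i ∈ t, f i) := maxNorm_mul_le _ _
      _ ≤ S * A * ((S : ℝ) ^ t.card * A ^ t.card) := by
          refine mul_le_mul (mul_le_mul ?_ (ha a (Finset.mem_insert_self a t)) (maxNorm_nonneg _)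
            (Nat.cast_nonneg _)) ih' (maxNorm_nonneg _) (mul_nonneg (Nat.cast_nonneg _) hA)
          exact_mod_cast hs a (Finset.mem_insert_self a t)
      _ = (S : ℝ) ^ t.card * S * (A ^ t.card * A) := by ring

/-- **Telescoping**: `|∏ᵢ fᵢ − ∏ᵢ gᵢ| ≤ n Sⁿ A^{n−1} η` for `n` factors with `#supp fᵢ, #supp gᵢ,
#supp(fᵢ − gᵢ) ≤ S`, `|fᵢ|, |gᵢ| ≤ A`, `|fᵢ − gᵢ| ≤ η`. [folklore] -/
theorem maxNorm_prod_sub_prod_le {ι : Type*} (t : Finset ι) (f g : ι → MvPolynomial σ K)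
    {S : ℕ} {A η : ℝ} (hA : 0 ≤ A) (hη : 0 ≤ η)
    (hsf : ∀ i ∈ t, (f i).support.card ≤ S) (hsg : ∀ i ∈ t, (g i).support.card ≤ S)
    (hsd : ∀ i ∈ t, (f i - g i).support.card ≤ S)
    (hf : ∀ i ∈ t, maxNorm (f i) ≤ A) (hg : ∀ i ∈ t, maxNorm (g i) ≤ A)
    (hd : ∀ i ∈ t, maxNorm (f i - g i) ≤ η) :
    maxNorm (∏ i ∈ t, f i - ∏ i ∈ t, g i) ≤ t.card * (S : ℝ) ^ t.card * A ^ (t.card - 1) * η := by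
  classical
  induction t using Finset.induction_on with
  | empty => simp
  | insert a t hat ih =>
    have mem : ∀ i ∈ t, i ∈ insert a t := fun i hi => Finset.mem_insert_of_mem hi
    have ih' := ih (fun i hi => hsf i (mem i hi)) (fun i hi => hsg i (mem i hi))
      (fun i hi => hsd i (mem i hi)) (fun i hi => hf i (mem i hi)) (fun i hi => hg i (mem i hi))
      fun i hi => hd i (mem i hi)
    have ha := Finset.mem_insert_self a t
    rw [Finset.prod_insert hat, Finset.prod_insert hat, Finset.card_insert_of_notMem hat,
      Nat.add_sub_cancel]
    have hPg : maxNorm (∏ i ∈ t, g i) ≤ (S : ℝ) ^ t.card * A ^ t.card :=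
      maxNorm_prod_le t g hA (fun i hi => hsg i (mem i hi)) fun i hi => hg i (mem i hi)
    have hSa : ((f a).support.card : ℝ) ≤ S := by exact_mod_cast hsf a ha
    have hSd : ((f a - g a).support.card : ℝ) ≤ S := by exact_mod_cast hsd a ha
    have e : f a * ∏ i ∈ t, f i - g a * ∏ i ∈ t, g i =
        f a * (∏ i ∈ t, f i - ∏ i ∈ t, g i) + (f a - g a) * ∏ i ∈ t, g i := by ring
    have hc : A * ((t.card : ℝ) * (S : ℝ) ^ t.card * A ^ (t.card - 1) * η) =
        t.card * (S : ℝ) ^ t.card * A ^ t.card * η := by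
      rcases Nat.eq_zero_or_pos t.card with hc | hc
      · rw [hc]; simp
      · obtain ⟨c, hc'⟩ : ∃ c, t.card = c + 1 := ⟨t.card - 1, by omega⟩
        rw [hc', Nat.add_sub_cancel, pow_succ]; ring
    rw [e]
    calc maxNorm (f a * (∏ i ∈ t, f i - ∏ i ∈ t, g i) + (f a - g a) * ∏ i ∈ t, g i)
        ≤ maxNorm (f a * (∏ i ∈ t, f i - ∏ i ∈ t, g i)) + maxNorm ((f a - g a) * ∏ i ∈ t, g i) :=
          maxNorm_add_le _ _
      _ ≤ (f a).support.card * maxNorm (f a) * maxNorm (∏ i ∈ t, f i - ∏ i ∈ t, g i) +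
            (f a - g a).support.card * maxNorm (f a - g a) * maxNorm (∏ i ∈ t, g i) :=
          add_le_add (maxNorm_mul_le _ _) (maxNorm_mul_le _ _)
      _ ≤ S * A * ((t.card : ℝ) * (S : ℝ) ^ t.card * A ^ (t.card - 1) * η) +
            S * η * ((S : ℝ) ^ t.card * A ^ t.card) := by
          refine add_le_add ?_ ?_
          · refine mul_le_mul (mul_le_mul hSa (hf a ha) (maxNorm_nonneg _) (Nat.cast_nonneg _))
              ih' (maxNorm_nonneg _) (mul_nonneg (Nat.cast_nonneg _) hA)
          · refine mul_le_mul (mul_le_mul hSd (hd a ha) (maxNorm_nonneg _) (Nat.cast_nonneg _))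
              hPg (maxNorm_nonneg _) (mul_nonneg (Nat.cast_nonneg _) hη)
      _ = ((t.card + 1 : ℕ) : ℝ) * (S : ℝ) ^ (t.card + 1) * A ^ t.card * η := by
          rw [mul_assoc (S : ℝ) A, hc, pow_succ]
          push_cast
          ring

end MaxNorm

/-! ### Monomials as products of linear factors -/

/-- `∏ᵥ x_v^{d_v}` as a product over `∑ d_v` single factors. [folklore] -/
theorem prod_pow_eq_prod_sigma {τ R : Type*} [Fintype τ] [CommMonoid R] (x : τ → R) (d : τ →₀ ℕ) :
    ∏ v, x v ^ d v = ∏ p ∈ Finset.univ.sigma (fun v => Finset.range (d v)), x p.1 := by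
  rw [Finset.prod_sigma]
  refine Finset.prod_congr rfl fun v _ => ?_
  show x v ^ d v = ∏ _j ∈ Finset.range (d v), x v
  rw [Finset.prod_const, Finset.card_range]

/-- … with `∑ᵥ d_v` factors. [folklore] -/
theorem card_sigma_range {τ : Type*} [Fintype τ] (d : τ →₀ ℕ) :
    (Finset.univ.sigma fun v => Finset.range (d v)).card = ∑ v, d v := by
  rw [Finset.card_sigma]
  simp only [Finset.card_range]

/-- `aeval x G − aeval y G = ∑_e a_e (x^e − y^e)`. [folklore] -/
theorem aeval_sub_aeval_eq {τ A : Type*} [Fintype τ] [CommRing A] [Algebra ℚ A]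
    (x y : τ → A) (G : MvPolynomial τ ℚ) :
    aeval x G - aeval y G =
      ∑ e ∈ G.support, algebraMap ℚ A (coeff e G) * (∏ v, x v ^ e v - ∏ v, y v ^ e v) := by
  rw [aeval_def, aeval_def, eval₂_eq', eval₂_eq', ← Finset.sum_sub_distrib]
  refine Finset.sum_congr rfl fun e _ => ?_
  ring

/-! ### The linear factors `(S⁽ⁱ⁾ω̄)_j` -/

/-- A single entry `±s_{jk} ω_k` has at most one monomial. [folklore] -/
theorem card_support_skewEntry_mul_C_le {r : ℕ} (i : Fin r) (j k : Fin (m + 1)) (c : ℂ) :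
    (skewEntry (m := m) i j k * C c).support.card ≤ 1 := by
  classical
  unfold skewEntry
  split_ifs with h h'
  · rw [mul_comm, C_mul_X_eq_monomial]
    exact (Finset.card_le_card (support_monomial_subset)).trans (by simp)
  · rw [neg_mul, support_neg, mul_comm, C_mul_X_eq_monomial]
    exact (Finset.card_le_card (support_monomial_subset)).trans (by simp)
  · simp

/-- … and coefficients of modulus `≤ |c|`. [folklore] -/
theorem maxNorm_skewEntry_mul_C_le {r : ℕ} (i : Fin r) (j k : Fin (m + 1)) (c : ℂ) :
    maxNorm (skewEntry (m := m) i j k * C c) ≤ ‖c‖ := by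
  classical
  unfold skewEntry
  split_ifs with h h'
  · rw [mul_comm, C_mul_X_eq_monomial]
    exact maxNorm_monomial_le _ _
  · rw [neg_mul, maxNorm_neg, mul_comm, C_mul_X_eq_monomial]
    exact maxNorm_monomial_le _ _
  · rw [zero_mul, maxNorm_zero]
    exact norm_nonneg c

/-- The linear factor `(S⁽ⁱ⁾ω̄)_j` has at most `m + 1` monomials. [folklore] -/
theorem card_support_linFactor_le {r : ℕ} (ω : Fin (m + 1) → ℂ) (v : Fin r × Fin (m + 1)) :
    ((∑ k : Fin (m + 1), skewEntry v.1 v.2 k * C (ω k) : RS r m)).support.card ≤ m + 1 := by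
  classical
  have h1 : ((∑ k : Fin (m + 1), skewEntry v.1 v.2 k * C (ω k) : RS r m)).support ⊆
      Finset.univ.biUnion fun k : Fin (m + 1) => (skewEntry v.1 v.2 k * C (ω k) : RS r m).support :=
    support_sum
  have h2 : ∑ k : Fin (m + 1), (skewEntry v.1 v.2 k * C (ω k) : RS r m).support.card ≤
      ∑ _k : Fin (m + 1), 1 :=
    Finset.sum_le_sum fun k _ => card_support_skewEntry_mul_C_le v.1 v.2 k (ω k)
  have h3 : ∑ _k : Fin (m + 1), (1 : ℕ) = m + 1 := by simp
  exact (Finset.card_le_card h1).trans (Finset.card_biUnion_le.trans (h2.trans h3.le))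

/-- … and coefficients of modulus `≤ (m+1) B` if `|ω_k| ≤ B`. [folklore] -/
theorem maxNorm_linFactor_le {r : ℕ} {ω : Fin (m + 1) → ℂ} {B : ℝ} (hB : ∀ k, ‖ω k‖ ≤ B)
    (v : Fin r × Fin (m + 1)) :
    maxNorm (∑ k : Fin (m + 1), skewEntry v.1 v.2 k * C (ω k)) ≤ (m + 1) * B := by
  calc maxNorm (∑ k : Fin (m + 1), skewEntry v.1 v.2 k * C (ω k))
      ≤ ∑ k : Fin (m + 1), maxNorm (skewEntry v.1 v.2 k * C (ω k)) := maxNorm_sum_le _ _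
    _ ≤ ∑ k : Fin (m + 1), B :=
        Finset.sum_le_sum fun k _ => (maxNorm_skewEntry_mul_C_le _ _ _ _).trans (hB k)
    _ = (m + 1) * B := by simp

/-- The factors are linear in `ω̄`. [folklore] -/
theorem linFactor_sub {r : ℕ} (ω ω' : Fin (m + 1) → ℂ) (v : Fin r × Fin (m + 1)) :
    ∑ k : Fin (m + 1), skewEntry v.1 v.2 k * C (ω k) -
        ∑ k : Fin (m + 1), skewEntry v.1 v.2 k * C (ω' k) =
      ∑ k : Fin (m + 1), skewEntry v.1 v.2 k * C ((ω - ω') k) := by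
  rw [← Finset.sum_sub_distrib]
  refine Finset.sum_congr rfl fun k _ => ?_
  rw [Pi.sub_apply, map_sub, mul_sub]

/-! ### Counting monomials of the associated form -/

/-- `#supp(F) ≤ (deg I + 1)^{r(m+1)}` for the associated form `F` (all exponents `≤ deg I`).
[folklore] -/
theorem card_support_chowForm_le (I : Ideal (Rx m)) {r : ℕ} (hr : 0 < r) :
    (chowForm I r).support.card ≤ (ideg I r + 1) ^ (r * (m + 1)) := by
  classical
  calc (chowForm I r).support.card
      ≤ (Fintype.piFinset fun _ : Fin r × Fin (m + 1) => Finset.range (ideg I r + 1)).card := by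
        refine Finset.card_le_card_of_injOn (fun e => ⇑e) (fun e he => ?_) ?_
        · rw [Finset.mem_coe, Fintype.mem_piFinset]
          intro v
          refine Finset.mem_range.mpr (Nat.lt_succ_of_le ?_)
          have h := bdeg_eq_ideg_of_mem_support_chowForm I hr he v.1
          unfold bdeg at h
          rw [← h]
          exact Finset.single_le_sum (f := fun j => e (v.1, j)) (fun j _ => Nat.zero_le _)
            (Finset.mem_univ v.2)
        · intro e₁ _ e₂ _ h
          exact DFunLike.coe_injective h
    _ = (ideg I r + 1) ^ (r * (m + 1)) := by
        rw [Fintype.card_piFinset, Finset.prod_const, Finset.card_range, Finset.card_univ,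
          Fintype.card_prod, Fintype.card_fin, Fintype.card_fin]

/-- The numerical inequality `(d+1)^{r(m+1)} · (r d) · (m+1)^{2rd} ≤ e^{5m²d}` for `1 ≤ r ≤ m`.
[folklore] -/
theorem supp_mul_pow_le_exp (m r d : ℕ) (hm : 1 ≤ m) (hrm : r ≤ m) :
    ((d : ℝ) + 1) ^ (r * (m + 1)) * ((r : ℝ) * d) * ((m : ℝ) + 1) ^ (2 * (r * d)) ≤
      Real.exp (5 * (m : ℝ) ^ 2 * d) := by
  have hd0 : (0 : ℝ) ≤ d := Nat.cast_nonneg d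
  have hm0 : (0 : ℝ) ≤ m := Nat.cast_nonneg m
  have hr0 : (0 : ℝ) ≤ r := Nat.cast_nonneg r
  have hrm' : (r : ℝ) ≤ m := by exact_mod_cast hrm
  have hm1 : (1 : ℝ) ≤ m := by exact_mod_cast hm
  have h1 : ((d : ℝ) + 1) ^ (r * (m + 1)) ≤ Real.exp (d * m * (m + 1)) := by
    calc ((d : ℝ) + 1) ^ (r * (m + 1)) ≤ Real.exp d ^ (r * (m + 1)) :=
          pow_le_pow_left₀ (by positivity) (Real.add_one_le_exp _) _
      _ = Real.exp (d * (r * (m + 1) : ℕ)) := by rw [← Real.exp_nat_mul, mul_comm]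
      _ ≤ Real.exp (d * m * (m + 1)) := by
          refine Real.exp_le_exp.mpr ?_
          push_cast
          rw [mul_assoc]
          exact mul_le_mul_of_nonneg_left (mul_le_mul_of_nonneg_right hrm' (by positivity)) hd0
  have h2 : (r : ℝ) * d ≤ Real.exp (m * d) := by
    calc (r : ℝ) * d ≤ m * d := mul_le_mul_of_nonneg_right hrm' hd0
      _ ≤ m * d + 1 := by linarith
      _ ≤ Real.exp (m * d) := Real.add_one_le_exp _
  have h3 : ((m : ℝ) + 1) ^ (2 * (r * d)) ≤ Real.exp (2 * m * m * d) := by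
    calc ((m : ℝ) + 1) ^ (2 * (r * d)) ≤ Real.exp m ^ (2 * (r * d)) :=
          pow_le_pow_left₀ (by positivity) (Real.add_one_le_exp _) _
      _ = Real.exp (m * (2 * (r * d) : ℕ)) := by rw [← Real.exp_nat_mul, mul_comm]
      _ ≤ Real.exp (2 * m * m * d) := by
          refine Real.exp_le_exp.mpr ?_
          push_cast
          nlinarith [mul_nonneg hm0 hd0, mul_le_mul_of_nonneg_right hrm' (mul_nonneg hm0 hd0)]
  calc ((d : ℝ) + 1) ^ (r * (m + 1)) * ((r : ℝ) * d) * ((m : ℝ) + 1) ^ (2 * (r * d))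
      ≤ Real.exp (d * m * (m + 1)) * Real.exp (m * d) * Real.exp (2 * m * m * d) :=
        mul_le_mul (mul_le_mul h1 h2 (by positivity) (by positivity)) h3 (by positivity)
          (by positivity)
    _ = Real.exp ((3 * m ^ 2 + 2 * m) * d) := by
        rw [← Real.exp_add, ← Real.exp_add]
        congr 1
        ring
    _ ≤ Real.exp (5 * (m : ℝ) ^ 2 * d) := by
        refine Real.exp_le_exp.mpr ?_
        have h4 : (3 : ℝ) * m ^ 2 + 2 * m ≤ 5 * m ^ 2 := by nlinarith
        exact mul_le_mul_of_nonneg_right h4 hd0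

/-! ### The estimate behind Corollary 4.10 -/

/-- Arithmetic of the constant: `N (m+1)^N ((m+1)w)^{N−1} ((m+1) (p w)) = N (m+1)^{2N} w^N p`.
[folklore] -/
theorem const_identity (N : ℕ) (M w p : ℝ) :
    (N : ℝ) * M ^ N * (M * w) ^ (N - 1) * (M * (p * w)) = N * M ^ (2 * N) * w ^ N * p := by
  cases N with
  | zero => simp
  | succ n =>
    rw [Nat.add_sub_cancel, mul_pow]
    ring

/-- **The Lipschitz estimate for `ϰ`**: if every monomial of `F ∈ ℚ[U]` has total degree `N`,
`|ω_k|, |ω'_k| ≤ B` and `|ω_k − ω'_k| ≤ δ`, then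
`|ϰ_ω̄(F) − ϰ_ω̄'(F)| ≤ #supp(F) · |F| · N (m+1)^N ((m+1)B)^{N−1} (m+1)δ`. [folklore] -/
theorem maxNorm_kappa_sub_kappa_le {r : ℕ} (F : RU r m) {N : ℕ}
    (hN : ∀ e ∈ F.support, ∑ v, e v = N) {ω ω' : Fin (m + 1) → ℂ} {B δ : ℝ} (hB : 0 ≤ B)
    (hδ : 0 ≤ δ) (hω : ∀ k, ‖ω k‖ ≤ B) (hω' : ∀ k, ‖ω' k‖ ≤ B) (hd : ∀ k, ‖ω k - ω' k‖ ≤ δ) :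
    maxNorm (kappa ω F - kappa ω' F) ≤
      F.support.card * maxNorm F *
        (N * ((m : ℝ) + 1) ^ N * (((m : ℝ) + 1) * B) ^ (N - 1) * (((m : ℝ) + 1) * δ)) := by
  classical
  unfold kappa
  generalize hx : (fun ij : Fin r × Fin (m + 1) =>
    (∑ k : Fin (m + 1), skewEntry ij.1 ij.2 k * C (ω k) : RS r m)) = x
  generalize hy : (fun ij : Fin r × Fin (m + 1) =>
    (∑ k : Fin (m + 1), skewEntry ij.1 ij.2 k * C (ω' k) : RS r m)) = y
  have hxS : ∀ v, (x v).support.card ≤ m + 1 := fun v => by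
    rw [← hx]; exact card_support_linFactor_le ω v
  have hyS : ∀ v, (y v).support.card ≤ m + 1 := fun v => by
    rw [← hy]; exact card_support_linFactor_le ω' v
  have hxyS : ∀ v, (x v - y v).support.card ≤ m + 1 := fun v => by
    rw [← hx, ← hy]; dsimp only; rw [linFactor_sub]; exact card_support_linFactor_le _ v
  have hxA : ∀ v, maxNorm (x v) ≤ (m + 1) * B := fun v => by
    rw [← hx]; exact maxNorm_linFactor_le hω v
  have hyA : ∀ v, maxNorm (y v) ≤ (m + 1) * B := fun v => by
    rw [← hy]; exact maxNorm_linFactor_le hω' v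
  have hxyη : ∀ v, maxNorm (x v - y v) ≤ (m + 1) * δ := fun v => by
    rw [← hx, ← hy]; dsimp only; rw [linFactor_sub]
    exact maxNorm_linFactor_le (fun k => by rw [Pi.sub_apply]; exact hd k) v
  have hA0 : (0 : ℝ) ≤ (m + 1) * B := by positivity
  have hη0 : (0 : ℝ) ≤ (m + 1) * δ := by positivity
  have hmono : ∀ e ∈ F.support, maxNorm (∏ v, x v ^ e v - ∏ v, y v ^ e v) ≤
      N * ((m + 1 : ℕ) : ℝ) ^ N * ((m + 1) * B) ^ (N - 1) * ((m + 1) * δ) := by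
    intro e he
    have h := maxNorm_prod_sub_prod_le (Finset.univ.sigma fun v => Finset.range (e v))
      (fun p => x p.1) (fun p => y p.1) hA0 hη0 (fun p _ => hxS p.1) (fun p _ => hyS p.1)
      (fun p _ => hxyS p.1) (fun p _ => hxA p.1) (fun p _ => hyA p.1) fun p _ => hxyη p.1
    rw [card_sigma_range, hN e he, ← prod_pow_eq_prod_sigma x e, ← prod_pow_eq_prod_sigma y e] at h
    exact h
  rw [aeval_sub_aeval_eq]
  calc maxNorm (∑ e ∈ F.support, algebraMap ℚ (RS r m) (coeff e F) *
          (∏ v, x v ^ e v - ∏ v, y v ^ e v))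
      ≤ ∑ e ∈ F.support, maxNorm (algebraMap ℚ (RS r m) (coeff e F) *
          (∏ v, x v ^ e v - ∏ v, y v ^ e v)) := maxNorm_sum_le _ _
    _ ≤ ∑ _e ∈ F.support, maxNorm F *
          (N * ((m + 1 : ℕ) : ℝ) ^ N * ((m + 1) * B) ^ (N - 1) * ((m + 1) * δ)) := by
        refine Finset.sum_le_sum fun e he => ?_
        rw [MvPolynomial.algebraMap_apply]
        refine (maxNorm_C_mul_le _ _).trans ?_
        refine mul_le_mul ?_ (hmono e he) (maxNorm_nonneg _) (maxNorm_nonneg _)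
        have hn : ‖algebraMap ℚ ℂ (coeff e F)‖ = ‖coeff e F‖ := by
          rw [eq_ratCast, Complex.norm_ratCast, ← Real.norm_eq_abs, Rat.norm_cast_real]
        rw [hn]
        exact norm_coeff_le_maxNorm F e
    _ = F.support.card * maxNorm F *
          (N * ((m : ℝ) + 1) ^ N * (((m : ℝ) + 1) * B) ^ (N - 1) * (((m : ℝ) + 1) * δ)) := by
        rw [Finset.sum_const, nsmul_eq_mul]
        push_cast
        ring

/-- **The estimate behind Corollary 4.10**, for an arbitrary ideal `I`: if `β̄ ∈ V(I)` then
`|I(ω̄)| ≤ ‖ω̄ − β̄‖ · e^{5 m² deg I}` (`1 ≤ r ≤ m`).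
[cite: NesterenkoPhilippon2001, Ch. 3 Cor. 4.10 (p. 40); Nes10 §1 Cor. 2] -/
theorem iabs_le_projDist_mul_exp {r : ℕ} (hr : 0 < r) (hrm : r ≤ m) (I : Ideal (Rx m))
    {ω β : Fin (m + 1) → ℂ} (hω : ω ≠ 0) (hβ : β ∈ projZeros I) :
    iabs I r ω ≤ projDist ω β * Real.exp (5 * (m : ℝ) ^ 2 * ideg I r) := by
  classical
  have hm : 1 ≤ m := le_trans hr hrm
  have hω0 : 0 < ‖ω‖ := norm_pos_iff.mpr hω
  have hp0 : 0 ≤ projDist ω β := projDist_nonneg ω β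
  obtain ⟨c, hc1, hc2⟩ := exists_rep_near hω hβ.1
  have hN : ∀ e ∈ (chowForm I r).support, ∑ v, e v = r * ideg I r := fun e he => by
    rw [← Finsupp.degree_eq_sum]
    exact degree_eq_of_mem_support_chowForm I hr he
  have hcard : ((chowForm I r).support.card : ℝ) ≤ ((ideg I r : ℝ) + 1) ^ (r * (m + 1)) := by
    exact_mod_cast card_support_chowForm_le I hr
  have hkey := maxNorm_kappa_sub_kappa_le (chowForm I r) hN hω0.le (mul_nonneg hp0 hω0.le)
    (fun k => norm_le_pi_norm ω k) hc1 hc2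
  rw [kappa_smul_chowForm_eq_zero I r hβ c, sub_zero] at hkey
  unfold iabs
  generalize hF : chowForm I r = F at hN hcard hkey ⊢
  generalize hd : ideg I r = d at hN hcard hkey ⊢
  have hRHS : 0 ≤ projDist ω β * Real.exp (5 * (m : ℝ) ^ 2 * (d : ℕ)) :=
    mul_nonneg hp0 (Real.exp_pos _).le
  by_cases hF0 : F = 0
  · subst hF0
    rw [kappa, map_zero, maxNorm_zero, zero_div]
    exact hRHS
  have hFpos : 0 < maxNorm F := maxNorm_pos hF0
  have hden : 0 < maxNorm F * ‖ω‖ ^ (r * d) := mul_pos hFpos (pow_pos hω0 _)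
  rw [div_le_iff₀ hden]
  have hconst : (F.support.card : ℝ) * (((r * d : ℕ) : ℝ) * ((m : ℝ) + 1) ^ (2 * (r * d))) ≤
      Real.exp (5 * (m : ℝ) ^ 2 * (d : ℕ)) := by
    calc (F.support.card : ℝ) * (((r * d : ℕ) : ℝ) * ((m : ℝ) + 1) ^ (2 * (r * d)))
        ≤ ((d : ℝ) + 1) ^ (r * (m + 1)) * (((r * d : ℕ) : ℝ) * ((m : ℝ) + 1) ^ (2 * (r * d))) :=
          mul_le_mul_of_nonneg_right hcard (by positivity)
      _ = ((d : ℝ) + 1) ^ (r * (m + 1)) * ((r : ℝ) * d) * ((m : ℝ) + 1) ^ (2 * (r * d)) := by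
          push_cast; ring
      _ ≤ Real.exp (5 * (m : ℝ) ^ 2 * d) := supp_mul_pow_le_exp m r d hm hrm
  calc maxNorm (kappa ω F)
      ≤ F.support.card * maxNorm F * (((r * d : ℕ) : ℝ) * ((m : ℝ) + 1) ^ (r * d) *
          (((m : ℝ) + 1) * ‖ω‖) ^ (r * d - 1) * (((m : ℝ) + 1) * (projDist ω β * ‖ω‖))) := hkey
    _ = maxNorm F * ‖ω‖ ^ (r * d) *
          (projDist ω β * (F.support.card * (((r * d : ℕ) : ℝ) * ((m : ℝ) + 1) ^ (2 * (r * d))))) := by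
        rw [const_identity]
        ring
    _ ≤ maxNorm F * ‖ω‖ ^ (r * d) * (projDist ω β * Real.exp (5 * (m : ℝ) ^ 2 * (d : ℕ))) :=
        mul_le_mul_of_nonneg_left (mul_le_mul_of_nonneg_left hconst hp0) hden.le
    _ = projDist ω β * Real.exp (5 * (m : ℝ) ^ 2 * (d : ℕ)) * (maxNorm F * ‖ω‖ ^ (r * d)) := by
        ring

/-! ### Corollary 4.10 -/

/-- **LNM 1752 Ch. 3 Corollary 4.10, (21)** (archimedean case, `K = ℚ`), discharged: for a
homogeneous prime `𝔭 ⊂ ℚ[x₀, …, x_m]` with `dim 𝔭 = r − 1 ≥ 0` and `ω̄ ∈ ℂ^{m+1} ∖ 0`,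
`|𝔭(ω̄)| ≤ ρ(ω̄) e^{5 m² deg 𝔭}`.
[cite: NesterenkoPhilippon2001, Ch. 3 Cor. 4.10, (21) (p. 40)] -/
theorem NesterenkoPhilippon2001_ch3_cor_4_10_holds : NesterenkoPhilippon2001_ch3_cor_4_10 := by
  intro m r 𝔭 hr hrm h𝔭 hhom hunm ω hω
  -- `𝔭` has no non-zero constants, being homogeneous and proper
  have hconst : ∀ P ∈ 𝔭, constantCoeff P = 0 := by
    intro P hP
    by_contra hc
    have h0 : C (constantCoeff P) ∈ 𝔭 := by
      rw [constantCoeff_eq, ← homogeneousComponent_zero]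
      exact homogeneousComponent_mem_of_mem hhom hP 0
    exact h𝔭.ne_top (Ideal.eq_top_of_isUnit_mem 𝔭 h0 ((isUnit_iff_ne_zero.mpr hc).map C))
  have hne : (projDist ω '' projZeros 𝔭).Nonempty :=
    (projZeros_nonempty 𝔭 hr h𝔭 hconst hunm).image _
  have hexp : 0 < Real.exp (5 * (m : ℝ) ^ 2 * ideg 𝔭 r) := Real.exp_pos _
  rw [← div_le_iff₀ hexp]
  refine le_csInf hne ?_
  rintro _ ⟨β, hβ, rfl⟩
  rw [div_le_iff₀ hexp]
  exact iabs_le_projDist_mul_exp hr hrm 𝔭 hω hβ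

end Nesterenko

end Literature.NumberTheory.Transcendental

end
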